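import Literature.NumberTheory.Weil1964.AdelicMetaplecticFinRep
import Literature.NumberTheory.Weil1964.AdelicMetaplecticScalarTwist
import Literature.NumberTheory.Automorphic.AdelicSchwartzBruhatTensorCharacter
import HarnessLib

-- buildfix G11b-3 recipe (LEDGER B13-1/B13-3): elaborate sequentially so the trailing `attribute [implicit_reducible]`
-- block (reducibilityCoreExt is keyed to the async environment branch) is in force at `.olean` export.
set_option Elab.async false

/-!
# The kernel of `π : Mp_ψ(𝕎_𝔸)ᶜᵒⁿᵗ → Sp(𝕎_𝔸)` is the group of central scalars

[GelbartRogawski1991, §3.1 p. 454 L21–33] (verbatim): "*The projection `π((g, M_g)) = g` yields an exact sequence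
`0 → ℂ* → Mp_𝐀(W) →π Sp_𝐀(W) → 0`.*"  [Weil1964, Chap. III n° 37 p. 188 L18–20] (verbatim, held text
`paper:doi-10-1007-bf02391012` p0046): "*On désignera de nouveau par `π` la projection de ce groupe sur `Ps(X)_A`;
elle est surjective et a pour noyau le groupe `{e} × T`, qu'on notera aussi, plus simplement, `T`*" (`T` = the
unimodular scalars, Weil's operators being unitary; for the algebraic model of pairs `(g, M)` with `M` a linear
automorphism the kernel is all of `ℂˣ`: [MoeglinVignerasWaldspurger1987, Chap. 2 II.1 (B)], "*De plus `M` est unique à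
un scalaire près*", the sequence `1 → ℂˣ → S̃p_ψ(W) → Sp(W) → 1`).

This file proves the exactness at the middle term for the tree's metaplectic group OF RECORD, the LF-continuous
implementing pairs `Mp_ψ(𝕎_𝔸)ᶜᵒⁿᵗ = adelicMpCont F ι T` of the global Schrödinger model on
`𝒮(𝔸_F^ι) = 𝓢((F ⊗ ℝ)^ι) ⊗ 𝒮((𝔸_F^∞)^ι)` (`AdelicMetaplecticContinuous`), for an invertible Gram matrix `T`:
**`adelicMpCont.exists_eq_ofScalar_of_proj_eq_one`** — `π(p) = 1 ⟹ p = (1, c·id)` for a (unique) `c ∈ ℂˣ` — with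
`adelicMpCont.proj_eq_one_iff`, `ker_proj_eq_range_ofScalar`, and `mem_center_of_proj_eq_one`, which is the hypothesis
`hker` of `GelbartRogawski1991.SplittingDatum.IsCompatible.exists_central_twist`, DISCHARGED at every splitting datum whose
`Mp` is `Mp_ψ(𝕎_𝔸)ᶜᵒⁿᵗ` with invertible Gram matrix (e.g. `UnitaryDualPair.splittingDatum`).

Proof: `π(p) = 1` fixes the archimedean vectors, so `ω(p) = 1 ⊗ B` (`exists_omega_eq_adelicTensorEnd_id_left`:
topological tensor stripping + Schur on `𝓢`); `1 ⊗ B` implements `1` on the finite Heisenberg elements, so `B` commutes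
with the finite Schrödinger operators (`comp_finSchrodinger_of_finImplementer`), hence is a scalar by the irreducibility of
the finite Schrödinger module (`eq_smul_id_of_comm`).  The same argument, at one splitting datum of the doubling method,
is `GelbartRogawski1991.DoubledWeilRepresentationRationalSchur.exists_smul_of_proj_eq_one`; here it is stated for every
`F`, `ι`, `T`.  Sequel: `AdelicMetaplecticTwistCharacter` (two homomorphisms over the same symplectic map differ by a
continuous character).

KERNEL MATHEMATICS ONLY: theorems; no definition, no named fact, no `sorry`.  Elaboration note: `obtain`/`rcases`
bookkeeping on elements of `Mp_ψ(𝕎_𝔸)ᶜᵒⁿᵗ` exhausts the default heartbeat budget where `Exists.elim` does not; the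
proofs below use the latter.

## References
* [Weil1964] A. Weil, *Sur certains groupes d'opérateurs unitaires*, Acta Math. 111 (1964) 143–211, Chap. III
  n° 37 p. 188 L18–20 (the kernel `T` of `Mp(X)_A → Ps(X)_A`), n° 37–38 pp. 188–190 (adelic case).
* [GelbartRogawski1991] S. Gelbart, J. Rogawski, *L-functions and Fourier–Jacobi coefficients for the unitary group
  U(3)*, Invent. Math. 105 (1991), §3.1 p. 454 L21–33 (the exact sequence), Remark p. 457 L9–13 (`s* = s ⊗ ν′`).
* [MoeglinVignerasWaldspurger1987] C. Mœglin, M.-F. Vignéras, J.-L. Waldspurger, *Correspondances de Howe sur un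
  corps p-adique*, LNM 1291 (1987), Chap. 2 II.1 (A)–(B), I.2–I.3 (irreducibility / Schur for `ρ_ψ`).
-/

set_option autoImplicit false

noncomputable section

open scoped Matrix TensorProduct
open NumberField NumberField.mixedEmbedding IsDedekindDomain

namespace Literature.NumberTheory.Weil1964

open Literature.NumberTheory.Automorphic Literature.RepresentationTheory.HeisenbergGroup

variable {F : Type} [Field F] [NumberField F] {ι : Type} [Fintype ι] [DecidableEq ι]
  {T : Matrix ι ι (AdeleRing (𝓞 F) F)}

/-! ## §1 The kernel of `π` is the circle of scalars -/

section Kernel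

/-- **Schur for the finite Schrödinger operators, `finHeisenberg` form**: a linear endomorphism of
`𝒮((𝔸_F^∞)^ι)` commuting with every `ρ_f(h)`, `h ∈ finHeisenberg T` (`T` invertible), is a scalar — the finite
translations and modulations are among these operators. [cite: MoeglinVignerasWaldspurger1987, Chap. 2 I.2–I.3] -/
theorem exists_eq_smul_id_of_comp_finSchrodinger (hT : IsUnit T) {B : FinSB F ι →ₗ[ℂ] FinSB F ι}
    (hB : ∀ h ∈ finHeisenberg T, B ∘ₗ finSchrodinger T h = finSchrodinger T h ∘ₗ B) :
    ∃ c : ℂ, B = c • LinearMap.id := by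
  have hT' : Function.Surjective fun y : ι → AdeleRing (𝓞 F) F => T *ᵥ y :=
    Matrix.mulVec_surjective_iff_isUnit.2 hT
  refine eq_smul_id_of_comm B (fun k f => ?_) (fun y f => ?_)
  · obtain ⟨h, hh, hk⟩ : ∃ h ∈ finHeisenberg T, finSchrodinger T h = finTranslateSB F ι k :=
      ⟨_, ofVec_mem_finHeisenberg (finIdem_smul_piAdeleSplit_zero k) (smul_zero _), finSchrodinger_ofVec_inl T k⟩
    rw [← hk]
    exact LinearMap.congr_fun (hB h hh) f
  · obtain ⟨y', hy', hTy'⟩ := exists_fin_mulVec_eq hT' y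
    obtain ⟨h, hh, hy⟩ : ∃ h ∈ finHeisenberg T, finSchrodinger T h = finModulateSB F ι y :=
      ⟨_, ofVec_mem_finHeisenberg (smul_zero _) hy', finSchrodinger_ofVec_inr T hTy'⟩
    rw [← hy]
    exact LinearMap.congr_fun (hB h hh) f

/-- the operators `ω(p)` are injective (they are linear automorphisms `M ∈ GL(S)`). [cite: MoeglinVignerasWaldspurger1987, Chap. 2 II.1 (A)] -/
theorem adelicMpCont.omega_injective (p : adelicMpCont F ι T) :
    Function.Injective (adelicMpCont.omega F ι T p) :=
  (MpPsi.toOp (adelicSchrodinger F ι T) (p : adelicMp F ι T)).injective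

/-- `ω(p) Φ ≠ 0` for `Φ ≠ 0` (the `M` of a pair `(g, M)` is an automorphism). [cite: MoeglinVignerasWaldspurger1987, Chap. 2 II.1 (A)] -/
theorem adelicMpCont.omega_apply_ne_zero (p : adelicMpCont F ι T) {Φ : piSchwartzBruhat F ι} (hΦ : Φ ≠ 0) :
    adelicMpCont.omega F ι T p Φ ≠ 0 := fun h0 =>
  hΦ (adelicMpCont.omega_injective p (h0.trans (map_zero _).symm))

/-- the implementer relation of `p ∈ Mp_ψ(𝕎_𝔸)ᶜᵒⁿᵗ` in the `ω`/`π` vocabulary: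
`ω(p) ρ(h) = ρ(π(p)·h) ω(p)`. [cite: MoeglinVignerasWaldspurger1987, Chap. 2 II.1 (A)] -/
theorem adelicMpCont.omega_adelicSchrodinger (p : adelicMpCont F ι T) (h : AdelicHeisenberg F ι T)
    (Φ : piSchwartzBruhat F ι) :
    adelicMpCont.omega F ι T p (adelicSchrodinger F ι T h Φ) =
      adelicSchrodinger F ι T ((ofSymplectic _ (adelicMpCont.proj F ι T p)).act h) (adelicMpCont.omega F ι T p Φ) :=
  (mem_MpPsi (adelicSchrodinger F ι T) _).1 (p : adelicMp F ι T).2 h Φ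

/-- an element over `1 ∈ Sp(𝕎_𝔸)` fixes the archimedean vectors, so its operator is `1 ⊗ B` (`T` invertible;
`exists_omega_eq_adelicTensorEnd_id_left`). [cite: Weil1964, Chap. III n° 37–38 pp. 188–190] -/
theorem adelicMpCont.exists_omega_eq_adelicTensorEnd_of_proj_eq_one (hT : IsUnit T) (p : adelicMpCont F ι T)
    (hp : adelicMpCont.proj F ι T p = 1) :
    ∃ B : FinSB F ι →ₗ[ℂ] FinSB F ι, adelicMpCont.omega F ι T p = adelicTensorEnd LinearMap.id B :=
  exists_omega_eq_adelicTensorEnd_id_left hT p (fun a w => by rw [hp]; rfl)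

/-- if `ω(p) = 1 ⊗ B`, then `1 ⊗ B` implements `π(p)` on the finite Heisenberg elements. [cite: MoeglinVignerasWaldspurger1987, Chap. 2 II.1 (A)] -/
theorem adelicMpCont.finImplementer_of_omega_eq (p : adelicMpCont F ι T) {B : FinSB F ι →ₗ[ℂ] FinSB F ι}
    (hB : adelicMpCont.omega F ι T p = adelicTensorEnd LinearMap.id B) :
    ∀ h ∈ finHeisenberg T, ∀ Φ : piSchwartzBruhat F ι,
      adelicTensorEnd LinearMap.id B (adelicSchrodinger F ι T h Φ) =
        adelicSchrodinger F ι T ((ofSymplectic _ (adelicMpCont.proj F ι T p)).act h)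
          (adelicTensorEnd LinearMap.id B Φ) :=
  fun h _ Φ =>
    (LinearMap.congr_fun hB (adelicSchrodinger F ι T h Φ)).symm.trans
      ((adelicMpCont.omega_adelicSchrodinger p h Φ).trans
        (congrArg (adelicSchrodinger F ι T ((ofSymplectic _ (adelicMpCont.proj F ι T p)).act h))
          (LinearMap.congr_fun hB Φ)))

/-- if `π(p) = 1` and `ω(p) = 1 ⊗ B`, then `B` commutes with the finite Schrödinger operators.
[cite: MoeglinVignerasWaldspurger1987, Chap. 2 II.1 (A)] -/
theorem adelicMpCont.comp_finSchrodinger_of_proj_eq_one (p : adelicMpCont F ι T)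
    (hp : adelicMpCont.proj F ι T p = 1) {B : FinSB F ι →ₗ[ℂ] FinSB F ι}
    (hB : adelicMpCont.omega F ι T p = adelicTensorEnd LinearMap.id B) {h : AdelicHeisenberg F ι T}
    (hh : h ∈ finHeisenberg T) : B ∘ₗ finSchrodinger T h = finSchrodinger T h ∘ₗ B := by
  have key := comp_finSchrodinger_of_finImplementer (Mf := B) (adelicMpCont.finImplementer_of_omega_eq p hB) hh
  have h1 : (ofSymplectic (polar (adelicForm F ι T)) (adelicMpCont.proj F ι T p)).act h = h := by
    rw [hp, map_one, Heisenberg.PseudoSymplectic.act_one]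
  rw [h1] at key
  exact key

/-- bookkeeping: `ω(p) = 1 ⊗ (c·id)` means `ω(p) Φ = c • Φ`. [cite: Weil1964, Chap. III n° 37–38 pp. 188–190] -/
theorem adelicMpCont.omega_eq_smul_of_finPart_eq (p : adelicMpCont F ι T) {B : FinSB F ι →ₗ[ℂ] FinSB F ι} {c : ℂ}
    (hB : adelicMpCont.omega F ι T p = adelicTensorEnd LinearMap.id B) (hc : B = c • LinearMap.id)
    (Φ : piSchwartzBruhat F ι) : adelicMpCont.omega F ι T p Φ = c • Φ := by
  rw [hB, hc, adelicTensorEnd_smul_right, LinearMap.smul_apply, adelicTensorEnd_id, LinearMap.id_apply]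

/-- **An element of `Mp_ψ(𝕎_𝔸)ᶜᵒⁿᵗ` over `1 ∈ Sp(𝕎_𝔸)` acts on `𝒮(𝔸_F^ι)` by a scalar** (`T` invertible): `ω(p) = 1 ⊗ B`
with `B` in the commutant of the finite Schrödinger module, a scalar by Schur.
[cite: Weil1964, Chap. III n° 37 p. 188 L18–20; MoeglinVignerasWaldspurger1987, Chap. 2 II.1 (B)] -/
theorem adelicMpCont.exists_omega_eq_smul_of_proj_eq_one (hT : IsUnit T) (p : adelicMpCont F ι T)
    (hp : adelicMpCont.proj F ι T p = 1) :
    ∃ c : ℂ, ∀ Φ : piSchwartzBruhat F ι, adelicMpCont.omega F ι T p Φ = c • Φ := by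
  -- (`Exists.elim` rather than `obtain`: `rcases` bookkeeping on these carriers exhausts the default budget)
  refine (adelicMpCont.exists_omega_eq_adelicTensorEnd_of_proj_eq_one hT p hp).elim fun B hB => ?_
  refine (exists_eq_smul_id_of_comp_finSchrodinger hT
    fun h hh => adelicMpCont.comp_finSchrodinger_of_proj_eq_one p hp hB hh).elim fun c hc => ?_
  exact ⟨c, fun Φ => adelicMpCont.omega_eq_smul_of_finPart_eq p hB hc Φ⟩

/-- an element over `1` whose operator is `c · id` IS the central scalar `(1, c·id)` (the map `i : c ↦ (1, c·id)` of (B)). [cite: MoeglinVignerasWaldspurger1987, Chap. 2 II.1 (B)] -/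
theorem adelicMpCont.eq_ofScalar_of_forall_omega_eq (p : adelicMpCont F ι T) (hp : adelicMpCont.proj F ι T p = 1)
    (c : ℂˣ) (hc : ∀ Φ : piSchwartzBruhat F ι, adelicMpCont.omega F ι T p Φ = (c : ℂ) • Φ) :
    p = adelicMpCont.ofScalar F ι T c :=
  Subtype.ext (Subtype.ext (Prod.ext hp (LinearEquiv.ext fun Φ => hc Φ)))

/-- **Exactness of `1 → ℂˣ → Mp_ψ(𝕎_𝔸)ᶜᵒⁿᵗ → Sp(𝕎_𝔸)` at the middle term**: an element over `1` IS a central scalar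
`(1, c·id)`, `c ∈ ℂˣ` (`T` invertible). [cite: GelbartRogawski1991, §3.1 p. 454 L21–33; Weil1964, Chap. III n° 37 p. 188 L18–20] -/
theorem adelicMpCont.exists_eq_ofScalar_of_proj_eq_one (hT : IsUnit T) (p : adelicMpCont F ι T)
    (hp : adelicMpCont.proj F ι T p = 1) :
    ∃ c : ℂˣ, p = adelicMpCont.ofScalar F ι T c := by
  refine (adelicMpCont.exists_omega_eq_smul_of_proj_eq_one hT p hp).elim fun c hc => ?_
  -- `c ≠ 0`: `ω(p)` is injective and `𝒮(𝔸_F^ι) ≠ 0`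
  refine (exists_piSchwartzBruhat_ne_zero (K := F) ι).elim fun Φ₀ hΦ₀ => ?_
  have hc0 : c ≠ 0 := by
    intro h0
    subst h0
    exact adelicMpCont.omega_apply_ne_zero p hΦ₀ ((hc Φ₀).trans (zero_smul ℂ Φ₀))
  exact ⟨Units.mk0 c hc0, adelicMpCont.eq_ofScalar_of_forall_omega_eq p hp (Units.mk0 c hc0) hc⟩

/-- `π(p) = 1 ↔ p` is a central scalar. [cite: GelbartRogawski1991, §3.1 p. 454 L21–33] -/
theorem adelicMpCont.proj_eq_one_iff (hT : IsUnit T) (p : adelicMpCont F ι T) :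
    adelicMpCont.proj F ι T p = 1 ↔ p ∈ (adelicMpCont.ofScalar F ι T).range := by
  constructor
  · intro hp
    obtain ⟨c, rfl⟩ := adelicMpCont.exists_eq_ofScalar_of_proj_eq_one hT p hp
    exact ⟨c, rfl⟩
  · rintro ⟨c, rfl⟩
    rfl

/-- `ker π = ℂˣ·(1, id)`. [cite: GelbartRogawski1991, §3.1 p. 454 L21–33; MoeglinVignerasWaldspurger1987, Chap. 2 II.1 (B)] -/
theorem adelicMpCont.ker_proj_eq_range_ofScalar (hT : IsUnit T) :
    (adelicMpCont.proj F ι T).ker = (adelicMpCont.ofScalar F ι T).range :=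
  Subgroup.ext fun p => (MonoidHom.mem_ker).trans (adelicMpCont.proj_eq_one_iff hT p)

/-- **`ker π` is central** — the hypothesis `hker` of `GelbartRogawski1991.SplittingDatum.IsCompatible.exists_central_twist`
for any splitting datum whose `Mp` is `Mp_ψ(𝕎_𝔸)ᶜᵒⁿᵗ` (invertible Gram matrix). [cite: GelbartRogawski1991, §3.1 Remark p. 457 L9–13] -/
theorem adelicMpCont.mem_center_of_proj_eq_one (hT : IsUnit T) (p : adelicMpCont F ι T)
    (hp : adelicMpCont.proj F ι T p = 1) : p ∈ Subgroup.center (adelicMpCont F ι T) := by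
  obtain ⟨c, rfl⟩ := adelicMpCont.exists_eq_ofScalar_of_proj_eq_one hT p hp
  exact adelicMpCont.ofScalar_mem_center c

omit [DecidableEq ι] in
/-- the scalars are read off faithfully: `(1, c·id) = (1, c'·id) → c = c'` (`𝒮(𝔸_F^ι) ≠ 0`; injectivity of the `i` of (B)). [cite: MoeglinVignerasWaldspurger1987, Chap. 2 II.1 (B)] -/
theorem adelicMpCont.ofScalar_injective [DecidableEq ι] : Function.Injective (adelicMpCont.ofScalar F ι T) := by
  intro c c' h
  obtain ⟨Φ₀, hΦ₀⟩ := exists_piSchwartzBruhat_ne_zero (K := F) ι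
  have h1 := congrArg (fun q => adelicMpCont.omega F ι T q Φ₀) h
  simp only [adelicMpCont.omega_ofScalar] at h1
  exact Units.ext (smul_left_injective ℂ hΦ₀ h1)

end Kernel

/-! ### Build-lane note (ops-buildfix G11b-3 recipe, LEDGER B13-1, 2026-08-21)
`lean -o` (the hub build lane, never `lean`/the gate check) runs Lean 4.32's library-suggestion indexers
(`Lean.LibrarySuggestions.SymbolFrequency` / `SineQuaNon`, from their `exportEntriesFn`) over the statement of
every local theorem that is not a denied premise; on this family's statements (very large dependent binder
telescopes through the theta-kernel / dual-pair data) that fold runs for tens of minutes to hours and the build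
lane kills the job (incident G11b-3, run/shared/lean/ops/buildfix/G11b-3-DOSSIER.md). `isDeniedPremise` skips
`[implicit_reducible]` constants before any fold, and a reducibility status on a *theorem* is inert (Meta never
unfolds `thmInfo`; the kernel ignores the attribute), so the public theorems of this file are tagged
`[implicit_reducible]` purely to keep them out of that index. Only other effect: they are not offered by
`+suggestions` premise selectors. No statement or proof is changed; superseded if the operator lands a
deny-list form (`HarnessLib.PremiseIndex`). -/
set_option allowUnsafeReducibility true in
attribute [implicit_reducible]
  exists_eq_smul_id_of_comp_finSchrodinger adelicMpCont.omega_injective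
  adelicMpCont.omega_apply_ne_zero adelicMpCont.omega_adelicSchrodinger
  adelicMpCont.exists_omega_eq_adelicTensorEnd_of_proj_eq_one
  adelicMpCont.finImplementer_of_omega_eq adelicMpCont.comp_finSchrodinger_of_proj_eq_one
  adelicMpCont.omega_eq_smul_of_finPart_eq adelicMpCont.exists_omega_eq_smul_of_proj_eq_one
  adelicMpCont.eq_ofScalar_of_forall_omega_eq adelicMpCont.exists_eq_ofScalar_of_proj_eq_one
  adelicMpCont.proj_eq_one_iff adelicMpCont.ker_proj_eq_range_ofScalar
  adelicMpCont.mem_center_of_proj_eq_one adelicMpCont.ofScalar_injective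

end Literature.NumberTheory.Weil1964

end
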